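import Literature.NumberTheory.GaloisRepresentations.HochschildSerreLowDegree
import HarnessLib

/-!
# The Hochschild–Serre edge `H¹(G/N, H¹(N, M)) ↪ H²(G, M)` under `H²(G/N, M^N) = H³(G/N, M^N) = 0`

Let `G` be a profinite group, `N ⊴ G` a closed normal subgroup and `M` a discrete `G`-module.  The
Hochschild–Serre spectral sequence `E₂^{pq} = H^p(G/N, H^q(N, M)) ⟹ H^{p+q}(G, M)` (Harari,
*Galois Cohomology and Class Field Theory*, Thm. 1.44; for profinite `G` and closed `N` loc. cit.
p. 96; Neukirch–Schmidt–Wingberg (2.4.1)) has the exact sequence of low degree (Harari, Prop. A.66;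
NSW (2.1.4)/(1.6.7))

  `0 → H¹(G/N, M^N) → H¹(G, M) → H¹(N, M)^{G/N} → H²(G/N, M^N) → Ker(H²(G, M) → H²(N, M))`
  `    → H¹(G/N, H¹(N, M)) → H³(G/N, M^N)`.

Hence, **if `H²(G/N, M^N) = 0` and `H³(G/N, M^N) = 0`, the term `E₂^{1,1} = H¹(G/N, H¹(N, M))`
injects into `H²(G, M)`** (onto the kernel of the restriction to `N`).  This is the step
"`H²(G_k, –) = H³(G_k, –) = 0` (cohomological dimension of an MLF) `⟹ H¹(G_k, H¹(Δ, –)) ↪ H²(Π, –)`"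
of the proof of [AbsTopI] Thm. 2.6 (iii), second clause (S. Mochizuki, *Topics in Absolute
Anabelian Geometry I*, p. 23, via Lemma 2.7 (iii)), here for DISCRETE (e.g. torsion, `ℤ/lⁱ`)
coefficients — the `ℚ_l`-coefficient form used in print is reached from the finite levels by the
tower comparison (`ContinuousCohomologyTowerLimit*`), not in this file.

Neither Mathlib nor the tree has the spectral sequence; as in the sibling file
`HochschildSerreLowDegree` ((HS2): the COUNT `#H²(G, M) = #H¹(G/N, H¹(N, M))` under the extra
hypothesis `H²(N, M) = 0`) the edge is built by dimension shifting through the `G`- and `N`-acyclic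
coinduced module `C = C(G, M)` (`isSES_coind`, `subsingleton_coind`, `subsingleton_coind_restrict`,
`subsingleton_coind_invariants`) and its quotient `Q = C/M`:

* `δ₁ : H¹(G, Q) ⥲ H²(G, M)` (acyclicity of `C`);
* inflation `H¹(G/N, Q^N) ↪ H¹(G, Q)` (injective, `infOne_injective`);
* `H¹(δ_N) : H¹(G/N, Q^N) → H¹(G/N, H¹(N, M))` induced by the `G/N`-equivariant connecting map
  `δ_N : Q^N ↠ H¹(N, M)` of `0 → M → C → Q → 0` over `N` (`deltaNHom`, surjective as `H¹(N, C) = 0`;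
  kernel `X = im(C^N → Q^N)` with `Hⁱ(G/N, X) ≅ Hⁱ⁺¹(G/N, M^N)`): INJECTIVE when `H²(G/N, M^N) = 0`
  and SURJECTIVE when `H³(G/N, M^N) = 0`.

The edge map is `hsEdge := δ₁ ∘ Inf ∘ H¹(δ_N)⁻¹ : H¹(G/N, H¹(N, M)) →+ H²(G, M)`, and it is
injective (`hsEdge_injective`); NO hypothesis on `H²(N, M)` is needed (this is what distinguishes the
edge injection from the count (HS2)).  The identification of this map with the differential-free
edge of the spectral sequence is not stated (there is no spectral sequence in the tree to state it
in); what is proved is an injective homomorphism `E₂^{1,1} → H²` characterised by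
`hsEdge (H¹(δ_N) y) = δ₁ (Inf y)` (`hsEdge_cohomologyMap_deltaNHom`).

## Main results (namespace `Literature.NumberTheory.GaloisRepresentations`)

* generic, for a short exact sequence `0 → M₁ → M₂ → M₃ → 0` of discrete `G`-modules with
  `H¹(N, M₂) = 0`: `IsSES.cohomologyMap_deltaNHom_injective` (needs `H¹(G/N, M₂^N) = 0`,
  `H²(G/N, M₁^N) = 0`), `IsSES.cohomologyMap_deltaNHom_surjective` (needs `H²(G/N, M₂^N) = 0`,
  `H³(G/N, M₁^N) = 0`), `IsSES.deltaNCohomologyEquiv` (`H¹(G/N, M₃^N) ≃+ H¹(G/N, H¹(N, M₁))`),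
  `IsSES.hsEdge`, `IsSES.hsEdge_cohomologyMap_deltaNHom`, `IsSES.hsEdge_injective`
  (needs moreover `H¹(G, M₂) = 0`);
* for a discrete `G`-module `M` (coinduced shift): **`hsEdge N ρ : H¹(G/N, H¹(N, M)) →+ H²(G, M)`**
  and **`hsEdge_injective`** under `[Subsingleton H²(G/N, M^N)] [Subsingleton H³(G/N, M^N)]`;
  numerical corollary `natCard_one_hOneRep_le_natCard_two`.

Classical, undisputed homological algebra; nothing here bears on [IUTchIII] Cor. 3.12 (the consumer
is the refereed [AbsTopI] Thm. 2.6 (iii) row of the abc-iut cell, layer L4).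

## References
* D. Harari, *Galois Cohomology and Class Field Theory*, Universitext (2020), Thm. 1.44, Prop. A.66.
  [Harari2020]
* J. Neukirch, A. Schmidt, K. Wingberg, *Cohomology of Number Fields*, 2nd ed. (2008), (2.1.4),
  (2.4.1). [NeukirchSchmidtWingberg2008]
* J.-P. Serre, *Galois Cohomology* (1997), I §2.6 (b). [SerreGaloisCohomology1997]
* S. Mochizuki, *Topics in Absolute Anabelian Geometry I: Generalities*, J. Math. Sci. Univ. Tokyo 19
  (2012), proof of Thm. 2.6 (iii), p. 23. [MochizukiAbsTopI2012]
-/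

noncomputable section

open CategoryTheory ContinuousCohomology Function

universe u

namespace Literature.NumberTheory.GaloisRepresentations

open _root_.TopRep _root_.Topology _root_.Filter

variable {G : Type u} [Group G] [TopologicalSpace G] [IsTopologicalGroup G] [CompactSpace G] [T2Space G]
  [TotallyDisconnectedSpace G]
variable (N : Subgroup G) [N.Normal] [hN : IsClosed (N : Set G)]

/-! ### The edge for a dimension-shifting short exact sequence -/

namespace IsSES

variable {M₁ : Type u} [AddCommGroup M₁] [TopologicalSpace M₁] [DiscreteTopology M₁]
variable {M₂ : Type u} [AddCommGroup M₂] [TopologicalSpace M₂] [DiscreteTopology M₂]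
variable {M₃ : Type u} [AddCommGroup M₃] [TopologicalSpace M₃] [DiscreteTopology M₃]
variable {ρ₁ : ContinuousRep G ℤ M₁} {ρ₂ : ContinuousRep G ℤ M₂} {ρ₃ : ContinuousRep G ℤ M₃}
variable {f : ρ₁.toTopRep ⟶ ρ₂.toTopRep} {g : ρ₂.toTopRep ⟶ ρ₃.toTopRep}

omit [T2Space G] in
/-- **`H¹(δ_N) : H¹(G/N, M₃^N) → H¹(G/N, H¹(N, M₁))` is injective** when `H¹(N, M₂) = 0`,
`H¹(G/N, M₂^N) = 0` and `H²(G/N, M₁^N) = 0` (the kernel `X` of `δ_N : M₃^N ↠ H¹(N, M₁)` has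
`H¹(G/N, X) = 0`). [cite: Harari2020, Prop A.66] -/
theorem cohomologyMap_deltaNHom_injective (h : IsSES f g)
    [Subsingleton (continuousCohomology 1 ((ρ₂.restrict (subgroupIncl N)).toTopRep))]
    [Subsingleton (continuousCohomology 1 (ρ₂.quotientInvariants N).toTopRep)]
    [Subsingleton (continuousCohomology 2 (ρ₁.quotientInvariants N).toTopRep)] :
    Injective (cohomologyMap (deltaNHom N h) 1) := by
  haveI := subsingleton_one_imRep N h
  have hXQT := isSES_deltaNHom N h
  intro a b hab
  rw [← sub_eq_zero] at hab ⊢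
  rw [← map_sub] at hab
  obtain ⟨x, hx⟩ := hXQT.exists_map_one_eq_of_map_one_eq_zero _ hab
  rw [← hx, Subsingleton.elim x 0, map_zero]

omit [T2Space G] in
/-- **`H¹(δ_N) : H¹(G/N, M₃^N) → H¹(G/N, H¹(N, M₁))` is surjective** when `H¹(N, M₂) = 0`,
`H²(G/N, M₂^N) = 0` and `H³(G/N, M₁^N) = 0` (the kernel `X` of `δ_N` has `H²(G/N, X) = 0`).
[cite: Harari2020, Prop A.66] -/
theorem cohomologyMap_deltaNHom_surjective (h : IsSES f g)
    [Subsingleton (continuousCohomology 1 ((ρ₂.restrict (subgroupIncl N)).toTopRep))]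
    [Subsingleton (continuousCohomology 2 (ρ₂.quotientInvariants N).toTopRep)]
    [Subsingleton (continuousCohomology 3 (ρ₁.quotientInvariants N).toTopRep)] :
    Surjective (cohomologyMap (deltaNHom N h) 1) := by
  haveI := subsingleton_two_imRep N h
  have hXQT := isSES_deltaNHom N h
  intro z
  exact hXQT.exists_map_one_eq_of_δ₁_eq_zero z (Subsingleton.elim _ _)

/-- **`H¹(δ_N)` as an isomorphism `H¹(G/N, M₃^N) ≃+ H¹(G/N, H¹(N, M₁))`** when `H¹(N, M₂) = 0`,
`H¹(G/N, M₂^N) = H²(G/N, M₂^N) = 0` and `H²(G/N, M₁^N) = H³(G/N, M₁^N) = 0`.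
[cite: Harari2020, Prop A.66] -/
def deltaNCohomologyEquiv (h : IsSES f g)
    [Subsingleton (continuousCohomology 1 ((ρ₂.restrict (subgroupIncl N)).toTopRep))]
    [Subsingleton (continuousCohomology 1 (ρ₂.quotientInvariants N).toTopRep)]
    [Subsingleton (continuousCohomology 2 (ρ₂.quotientInvariants N).toTopRep)]
    [Subsingleton (continuousCohomology 2 (ρ₁.quotientInvariants N).toTopRep)]
    [Subsingleton (continuousCohomology 3 (ρ₁.quotientInvariants N).toTopRep)] :
    continuousCohomology 1 (ρ₃.quotientInvariants N).toTopRep ≃+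
      continuousCohomology 1 (hOneRep N ρ₁).toTopRep :=
  AddEquiv.ofBijective (cohomologyMap (deltaNHom N h) 1).hom.toLinearMap.toAddMonoidHom
    ⟨cohomologyMap_deltaNHom_injective N h, cohomologyMap_deltaNHom_surjective N h⟩

omit [T2Space G] in
/-- Unfolding `deltaNCohomologyEquiv`: it is `H¹(δ_N)`. [cite: Harari2020, Prop A.66] -/
@[simp] theorem deltaNCohomologyEquiv_apply (h : IsSES f g)
    [Subsingleton (continuousCohomology 1 ((ρ₂.restrict (subgroupIncl N)).toTopRep))]
    [Subsingleton (continuousCohomology 1 (ρ₂.quotientInvariants N).toTopRep)]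
    [Subsingleton (continuousCohomology 2 (ρ₂.quotientInvariants N).toTopRep)]
    [Subsingleton (continuousCohomology 2 (ρ₁.quotientInvariants N).toTopRep)]
    [Subsingleton (continuousCohomology 3 (ρ₁.quotientInvariants N).toTopRep)]
    (y : continuousCohomology 1 (ρ₃.quotientInvariants N).toTopRep) :
    deltaNCohomologyEquiv N h y = cohomologyMap (deltaNHom N h) 1 y := rfl

/-- **The edge `H¹(G/N, H¹(N, M₁)) →+ H²(G, M₁)` of a dimension-shifting sequence**:
`δ₁ ∘ Inf ∘ H¹(δ_N)⁻¹`. [cite: Harari2020, Thm 1.44] -/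
def hsEdge (h : IsSES f g)
    [Subsingleton (continuousCohomology 1 ((ρ₂.restrict (subgroupIncl N)).toTopRep))]
    [Subsingleton (continuousCohomology 1 (ρ₂.quotientInvariants N).toTopRep)]
    [Subsingleton (continuousCohomology 2 (ρ₂.quotientInvariants N).toTopRep)]
    [Subsingleton (continuousCohomology 2 (ρ₁.quotientInvariants N).toTopRep)]
    [Subsingleton (continuousCohomology 3 (ρ₁.quotientInvariants N).toTopRep)] :
    continuousCohomology 1 (hOneRep N ρ₁).toTopRep →+ continuousCohomology 2 ρ₁.toTopRep :=
  (h.δ₁.toAddMonoidHom.comp (infOne N ρ₃).hom.toLinearMap.toAddMonoidHom).comp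
    (deltaNCohomologyEquiv N h).symm.toAddMonoidHom

/-- **Characterisation of the edge**: `hsEdge (H¹(δ_N) y) = δ₁ (Inf y)` for every
`y ∈ H¹(G/N, M₃^N)`. [cite: Harari2020, Thm 1.44] -/
theorem hsEdge_cohomologyMap_deltaNHom (h : IsSES f g)
    [Subsingleton (continuousCohomology 1 ((ρ₂.restrict (subgroupIncl N)).toTopRep))]
    [Subsingleton (continuousCohomology 1 (ρ₂.quotientInvariants N).toTopRep)]
    [Subsingleton (continuousCohomology 2 (ρ₂.quotientInvariants N).toTopRep)]
    [Subsingleton (continuousCohomology 2 (ρ₁.quotientInvariants N).toTopRep)]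
    [Subsingleton (continuousCohomology 3 (ρ₁.quotientInvariants N).toTopRep)]
    (y : continuousCohomology 1 (ρ₃.quotientInvariants N).toTopRep) :
    h.hsEdge N (cohomologyMap (deltaNHom N h) 1 y) = h.δ₁ (infOne N ρ₃ y) := by
  have e : (deltaNCohomologyEquiv N h).symm (cohomologyMap (deltaNHom N h) 1 y) = y :=
    (deltaNCohomologyEquiv N h).symm_apply_eq.2 (deltaNCohomologyEquiv_apply N h y).symm
  change h.δ₁ (infOne N ρ₃ ((deltaNCohomologyEquiv N h).symm (cohomologyMap (deltaNHom N h) 1 y))) = _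
  rw [e]

/-- **The edge is injective** when moreover `H¹(G, M₂) = 0` (so that `δ₁ : H¹(G, M₃) → H²(G, M₁)`
is injective; inflation in degree one always is). [cite: Harari2020, Prop A.66] -/
theorem hsEdge_injective (h : IsSES f g)
    [Subsingleton (continuousCohomology 1 ρ₂.toTopRep)]
    [Subsingleton (continuousCohomology 1 ((ρ₂.restrict (subgroupIncl N)).toTopRep))]
    [Subsingleton (continuousCohomology 1 (ρ₂.quotientInvariants N).toTopRep)]
    [Subsingleton (continuousCohomology 2 (ρ₂.quotientInvariants N).toTopRep)]
    [Subsingleton (continuousCohomology 2 (ρ₁.quotientInvariants N).toTopRep)]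
    [Subsingleton (continuousCohomology 3 (ρ₁.quotientInvariants N).toTopRep)] :
    Injective (h.hsEdge N) :=
  ((δ₁_injective_of_subsingleton h).comp (infOne_injective N ρ₃)).comp
    (deltaNCohomologyEquiv N h).symm.injective

end IsSES

/-! ### The edge for a discrete `G`-module, through the coinduced shift -/

variable {M : Type u} [AddCommGroup M] [TopologicalSpace M] [DiscreteTopology M]
variable (ρ : ContinuousRep G ℤ M)

/-- **The Hochschild–Serre edge `H¹(G/N, H¹(N, M)) →+ H²(G, M)`** for a discrete module `M` over a
profinite group `G` and a closed normal subgroup `N`, under `H²(G/N, M^N) = 0` and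
`H³(G/N, M^N) = 0`: `δ₁ ∘ Inf ∘ H¹(δ_N)⁻¹` for the shift `0 → M → C(G, M) → Q → 0`
(`C(G, M)` is acyclic for `G` and `N`, `C(G, M)^N ≅ C(G/N, M)` for `G/N`).
[cite: Harari2020, Thm 1.44] [cite: NeukirchSchmidtWingberg2008, (2.4.1)] -/
def hsEdge [Subsingleton (continuousCohomology 2 (ρ.quotientInvariants N).toTopRep)]
    [Subsingleton (continuousCohomology 3 (ρ.quotientInvariants N).toTopRep)] :
    continuousCohomology 1 (hOneRep N ρ).toTopRep →+ continuousCohomology 2 ρ.toTopRep :=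
  haveI := subsingleton_coind_restrict N ρ 0
  haveI := subsingleton_coind_invariants N ρ 0
  haveI := subsingleton_coind_invariants N ρ 1
  (isSES_coind ρ).hsEdge N

/-- **The Hochschild–Serre edge `H¹(G/N, H¹(N, M)) → H²(G, M)` is injective** when
`H²(G/N, M^N) = 0` and `H³(G/N, M^N) = 0` — "`E₂^{2,0} = E₂^{3,0} = 0 ⟹ E₂^{1,1} ↪ H²`", the
low-degree exact sequence of the Hochschild–Serre spectral sequence; no hypothesis on `H²(N, M)`.
This is the step "`H¹(G_k, H¹(Δ, –)) ↪ H²(Π, –)` since `cd G_k = 2`" of the proof of [AbsTopI]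
Thm. 2.6 (iii) (p. 23), for discrete coefficients.
[cite: Harari2020, Prop A.66] [cite: NeukirchSchmidtWingberg2008, (2.4.1)]
[cite: MochizukiAbsTopI2012, Thm 2.6 (iii) proof p.23] -/
theorem hsEdge_injective [Subsingleton (continuousCohomology 2 (ρ.quotientInvariants N).toTopRep)]
    [Subsingleton (continuousCohomology 3 (ρ.quotientInvariants N).toTopRep)] :
    Injective (hsEdge N ρ) := by
  haveI := subsingleton_coind ρ 0
  haveI := subsingleton_coind_restrict N ρ 0
  haveI := subsingleton_coind_invariants N ρ 0
  haveI := subsingleton_coind_invariants N ρ 1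
  exact (isSES_coind ρ).hsEdge_injective N

/-- Numerical corollary: `#H¹(G/N, H¹(N, M)) ≤ #H²(G, M)` when `H²(G, M)` is finite and
`H²(G/N, M^N) = H³(G/N, M^N) = 0` (compare (HS2) `natCard_two_eq_natCard_one_hOneRep`, which is the
equality under the extra hypothesis `H²(N, M) = 0`). [cite: Harari2020, Prop A.66] -/
theorem natCard_one_hOneRep_le_natCard_two
    [Subsingleton (continuousCohomology 2 (ρ.quotientInvariants N).toTopRep)]
    [Subsingleton (continuousCohomology 3 (ρ.quotientInvariants N).toTopRep)]
    [Finite (continuousCohomology 2 ρ.toTopRep)] :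
    Nat.card (continuousCohomology 1 (hOneRep N ρ).toTopRep) ≤
      Nat.card (continuousCohomology 2 ρ.toTopRep) :=
  Nat.card_le_card_of_injective _ (hsEdge_injective N ρ)

/-- In particular **`H²(G, M) = 0` forces `H¹(G/N, H¹(N, M)) = 0`** (under
`H²(G/N, M^N) = H³(G/N, M^N) = 0`); contrapositively, a nonzero class in `E₂^{1,1}` yields a
nonzero class in `H²(G, M)` — the form in which [AbsTopI] Thm. 2.6 (iii) uses the edge.
[cite: MochizukiAbsTopI2012, Thm 2.6 (iii) proof p.23] -/
theorem subsingleton_one_hOneRep_of_subsingleton_two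
    [Subsingleton (continuousCohomology 2 (ρ.quotientInvariants N).toTopRep)]
    [Subsingleton (continuousCohomology 3 (ρ.quotientInvariants N).toTopRep)]
    [Subsingleton (continuousCohomology 2 ρ.toTopRep)] :
    Subsingleton (continuousCohomology 1 (hOneRep N ρ).toTopRep) :=
  (hsEdge_injective N ρ).subsingleton

end Literature.NumberTheory.GaloisRepresentations

end
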